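import Summits.SmoothPoincare4.SmoothPoincare4.Theorems.SymplecticOrigamiGromovRecognitionRelEndStubTameMoserAux3
import Mathlib.Analysis.SpecialFunctions.SmoothTransition
import Mathlib.Analysis.Calculus.MeanValue
import HarnessLib

/-!
# Moser's argument with compact support on a vector space (helper for stub `stub_tameMoser`)

Fourth helper file for stub `stub_tameMoser` of line `cross-cap-laurent` (crux
`GromovRecognitionRelEnd`, item stmt-SmoothPoincare4-11009), continuing `…StubTameMoserAux3`
(calculus lemmas). **Moser's isotopy with compact support** (McDuff–Salamon (2017), §3.2,
Thm. 3.2.4 and its proof; made relative to infinity): on a finite-dimensional real normed space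
`E`, let `ω₀, ω₁` be closed `C^∞` `2`-forms whose difference is `dβ` for a `C^∞` `1`-form `β`
with compact support, and such that every form of the segment `(1 − t) ω₁ + t ω₀`, `t ∈ [0, 1]`,
is nondegenerate. Then there is a diffeomorphism `ρ` of `E`, equal to the identity outside a
ball, with `ρ^* ω₀ = ω₁` (`moser_compactSupport`).

Proof: `ω_t = (1 − λ(t)) ω₁ + λ(t) ω₀` with Mathlib's smooth transition `λ`
(so that `ω_t` is defined and nondegenerate for all `t ∈ ℝ` and `∂ₜ ω_t = λ'(t) dβ` has compact
support in `[0, 1] × supp β`); the Moser field `ι_{V_t} ω_t = −λ'(t) β` is `C^∞` with compact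
support (`isInvertible_curryLeft_of_nondegenerate`, `contDiff_inverse_family`), so the tree's
time-dependent flow `Literature.Analysis.ODE.tdFlow` gives diffeomorphisms `ρ_t`, `ρ_0 = id`, equal
to the identity off a ball; and `t ↦ (ρ_t^* ω_t)_y(v, w)` is constant by the Leibniz rule
(`hasDerivAt_twoForm_apply`), the variational equation (`hasDerivAt_fderiv_flow`) and the pointwise
Moser–Cartan cancellation (`moser_pointwise`). Hence `ρ_1^* ω₀ = ω₁`.

Everything is proved; no definition, no named fact.

References: D. McDuff, D. Salamon, *Introduction to Symplectic Topology*, 3rd ed. (2017), §3.2;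
J. M. Lee, *Introduction to Smooth Manifolds*, 2nd ed. (2013), Thm. 22.16.
-/

noncomputable section

-- the prescribed namespace `Summit.<P>.<Sub>.…` duplicates `SmoothPoincare4` (P = Sub)
set_option linter.dupNamespace false

open scoped Manifold ContDiff Topology
open Set TopologicalSpace Literature.Geometry.Kaehler Literature.Geometry.Symplectic

namespace Summit.SmoothPoincare4.SmoothPoincare4.Theorems.GromovRecognitionRelEnd.CrossCapLaurent

variable {E : Type*} [NormedAddCommGroup E] [NormedSpace ℝ E]

/-! ## The smooth time reparametrisation -/

/-- The derivative of Mathlib's smooth transition vanishes for negative times. [folklore] -/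
theorem deriv_smoothTransition_of_neg {s : ℝ} (hs : s < 0) : deriv Real.smoothTransition s = 0 := by
  have h : Real.smoothTransition =ᶠ[𝓝 s] fun _ ↦ (0 : ℝ) :=
    (eventually_lt_nhds hs).mono fun t ht ↦ Real.smoothTransition.zero_of_nonpos ht.le
  rw [h.deriv_eq, deriv_const]

/-- The derivative of Mathlib's smooth transition vanishes for times `> 1`. [folklore] -/
theorem deriv_smoothTransition_of_one_lt {s : ℝ} (hs : 1 < s) :
    deriv Real.smoothTransition s = 0 := by
  have h : Real.smoothTransition =ᶠ[𝓝 s] fun _ ↦ (1 : ℝ) :=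
    (eventually_gt_nhds hs).mono fun t ht ↦ Real.smoothTransition.one_of_one_le ht.le
  rw [h.deriv_eq, deriv_const]

/-! ## The Moser field -/

/-- Insertion in the first slot, `Ω ↦ (v ↦ ι_v Ω)`, is a bounded linear map from `2`-forms to
`E →L (1-forms)` (an isometry, Mathlib's `ContinuousAlternatingMap.curryLeftLI`). [folklore] -/
theorem isBoundedLinearMap_curryLeft_two :
    IsBoundedLinearMap ℝ fun f : E [⋀^Fin 2]→L[ℝ] ℝ ↦
      (f.curryLeft : E →L[ℝ] E [⋀^Fin 1]→L[ℝ] ℝ) where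
  map_add f g := ContinuousAlternatingMap.curryLeft_add f g
  map_smul c f := ContinuousAlternatingMap.curryLeft_smul c f
  bound := ⟨1, one_pos, fun f ↦ by rw [one_mul, ContinuousAlternatingMap.norm_curryLeft]⟩

section Field

variable [FiniteDimensional ℝ E]

/-- **The Moser field is `C^∞`.** For `C^∞` forms `ω₀, ω₁, β` with every
`(1 − t) ω₁ + t ω₀`, `t ∈ [0,1]`, nondegenerate, the field
`V(t, x) = −λ'(t) (ι_• ω_{t,x})⁻¹ β_x`, `ω_t = (1 − λ(t)) ω₁ + λ(t) ω₀`, is `C^∞` on `ℝ × E`.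
[cite: McDuffSalamon2017, §3.2] -/
theorem contDiff_moserField {ω₀ ω₁ : E → E [⋀^Fin 2]→L[ℝ] ℝ} {β : E → E [⋀^Fin 1]→L[ℝ] ℝ}
    (hω₀ : ContDiff ℝ ∞ ω₀) (hω₁ : ContDiff ℝ ∞ ω₁) (hβ : ContDiff ℝ ∞ β)
    (hnd : ∀ (x : E) (t : ℝ), t ∈ Icc (0 : ℝ) 1 → ∀ v, v ≠ 0 →
      ∃ w, ((1 - t) • ω₁ x + t • ω₀ x) ![v, w] ≠ 0) :
    ContDiff ℝ ∞ fun p : ℝ × E ↦ -(deriv Real.smoothTransition p.1 •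
      (((1 - Real.smoothTransition p.1) • ω₁ p.2 + Real.smoothTransition p.1 • ω₀ p.2).curryLeft :
        E →L[ℝ] E [⋀^Fin 1]→L[ℝ] ℝ).inverse (β p.2)) := by
  haveI : CompleteSpace E := FiniteDimensional.complete ℝ E
  have hl : ContDiff ℝ ∞ Real.smoothTransition := Real.smoothTransition.contDiff
  have hl' : ContDiff ℝ ∞ (deriv Real.smoothTransition) := (contDiff_infty_iff_deriv.1 hl).2
  have hΩ : ContDiff ℝ ∞ fun p : ℝ × E ↦
      (1 - Real.smoothTransition p.1) • ω₁ p.2 + Real.smoothTransition p.1 • ω₀ p.2 :=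
    ((contDiff_const.sub (hl.comp contDiff_fst)).smul (hω₁.comp contDiff_snd)).add
      ((hl.comp contDiff_fst).smul (hω₀.comp contDiff_snd))
  have hA : ContDiff ℝ ∞ fun p : ℝ × E ↦
      (((1 - Real.smoothTransition p.1) • ω₁ p.2 + Real.smoothTransition p.1 • ω₀ p.2).curryLeft :
        E →L[ℝ] E [⋀^Fin 1]→L[ℝ] ℝ) :=
    by
    have hcl : ContDiff ℝ ∞ fun f : E [⋀^Fin 2]→L[ℝ] ℝ ↦
        (f.curryLeft : E →L[ℝ] E [⋀^Fin 1]→L[ℝ] ℝ) := isBoundedLinearMap_curryLeft_two.contDiff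
    exact hcl.comp hΩ
  have hinv := contDiff_inverse_family hA fun p ↦ isInvertible_curryLeft_of_nondegenerate _
    (hnd p.2 _ ⟨Real.smoothTransition.nonneg _, Real.smoothTransition.le_one _⟩)
  exact ((hl'.comp contDiff_fst).smul (hinv.clm_apply (hβ.comp contDiff_snd))).neg

omit [FiniteDimensional ℝ E] in
/-- **The Moser field has compact support** in `[0, 1] × supp β` (the transition is constant off
`[0, 1]`, and `V(t, x) = 0` where `β_x = 0`). [cite: McDuffSalamon2017, §3.2] -/
theorem hasCompactSupport_moserField {ω₀ ω₁ : E → E [⋀^Fin 2]→L[ℝ] ℝ}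
    {β : E → E [⋀^Fin 1]→L[ℝ] ℝ} (hβc : HasCompactSupport β) :
    HasCompactSupport fun p : ℝ × E ↦ -(deriv Real.smoothTransition p.1 •
      (((1 - Real.smoothTransition p.1) • ω₁ p.2 + Real.smoothTransition p.1 • ω₀ p.2).curryLeft :
        E →L[ℝ] E [⋀^Fin 1]→L[ℝ] ℝ).inverse (β p.2)) := by
  refine HasCompactSupport.intro (isCompact_Icc.prod hβc.isCompact
    (s := Icc (0 : ℝ) 1)) fun p hp ↦ ?_
  rw [Set.mem_prod, not_and_or] at hp
  rcases hp with h | h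
  · have h0 : deriv Real.smoothTransition p.1 = 0 := by
      rcases lt_or_ge p.1 0 with h1 | h1
      · exact deriv_smoothTransition_of_neg h1
      · have h2 : 1 < p.1 := by
          by_contra h2
          exact h ⟨h1, not_lt.1 h2⟩
        exact deriv_smoothTransition_of_one_lt h2
    rw [h0, zero_smul, neg_zero]
  · rw [image_eq_zero_of_notMem_tsupport h, map_zero, smul_zero, neg_zero]


omit [FiniteDimensional ℝ E] in
/-- Unfolding Mathlib's `extDeriv` (its definition): `dω x = Alt (Dω x)`. [folklore] -/
theorem extDeriv_eq_alternatizeUncurryFin {F : Type*} [NormedAddCommGroup F] [NormedSpace ℝ F]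
    {k : ℕ} (f : E → E [⋀^Fin k]→L[ℝ] F) (x : E) :
    extDeriv f x = ContinuousAlternatingMap.alternatizeUncurryFin (fderiv ℝ f x) := rfl

/-- **Moser's isotopy with compact support on a vector space** (McDuff–Salamon (2017), §3.2,
Thm. 3.2.4 and its proof, relative to infinity). On a finite-dimensional real normed space let
`ω₀, ω₁` be closed `C^∞` `2`-forms with `ω₀ − ω₁ = dβ`, `β` a `C^∞` `1`-form with compact
support, such that `(1 − t) ω₁ + t ω₀` is nondegenerate for all `t ∈ [0, 1]`. Then some
diffeomorphism `ρ` of `E`, equal to the identity outside a ball, satisfies `ρ^* ω₀ = ω₁`: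
`ω₁(x)(v, w) = ω₀(ρ x)(Dρ(x) v, Dρ(x) w)`. (`ρ` is the time-one map of the flow of the Moser field
`ι_{V_t} ω_t = −λ'(t) β`, `ω_t = (1 − λ(t)) ω₁ + λ(t) ω₀`.) [cite: McDuffSalamon2017, Thm. 3.2.4] -/
theorem moser_compactSupport {ω₀ ω₁ : E → E [⋀^Fin 2]→L[ℝ] ℝ} {β : E → E [⋀^Fin 1]→L[ℝ] ℝ}
    (hω₀ : ContDiff ℝ ∞ ω₀) (hω₁ : ContDiff ℝ ∞ ω₁) (hd₀ : extDeriv ω₀ = 0)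
    (hd₁ : extDeriv ω₁ = 0) (hβ : ContDiff ℝ ∞ β) (hβc : HasCompactSupport β)
    (hdβ : ∀ x, extDeriv β x = ω₀ x - ω₁ x)
    (hnd : ∀ (x : E) (t : ℝ), t ∈ Icc (0 : ℝ) 1 → ∀ v, v ≠ 0 →
      ∃ w, ((1 - t) • ω₁ x + t • ω₀ x) ![v, w] ≠ 0) :
    ∃ ρ : E ≃ₘ⟮𝓘(ℝ, E), 𝓘(ℝ, E)⟯ E,
      (∀ x v w, ω₁ x ![v, w] = ω₀ (ρ x) ![fderiv ℝ ρ x v, fderiv ℝ ρ x w]) ∧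
      ∃ R : ℝ, ∀ x, R ≤ ‖x‖ → ρ x = x := by
  haveI : CompleteSpace E := FiniteDimensional.complete ℝ E
  have hinf : (∞ : WithTop ℕ∞) ≠ 0 := by simp
  set lam : ℝ → ℝ := Real.smoothTransition with hlam_def
  set lam' : ℝ → ℝ := deriv Real.smoothTransition with hlam'_def
  have hl : ContDiff ℝ ∞ lam := Real.smoothTransition.contDiff
  have hld : ∀ s, HasDerivAt lam (lam' s) s := fun s ↦ (hl.differentiable hinf s).hasDerivAt
  have hl01 : ∀ s, lam s ∈ Icc (0 : ℝ) 1 := fun s ↦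
    ⟨Real.smoothTransition.nonneg _, Real.smoothTransition.le_one _⟩
  set Ω : ℝ → E → E [⋀^Fin 2]→L[ℝ] ℝ := fun s x ↦ (1 - lam s) • ω₁ x + lam s • ω₀ x with hΩ_def
  set A : ℝ → E → (E →L[ℝ] E [⋀^Fin 1]→L[ℝ] ℝ) := fun s x ↦ (Ω s x).curryLeft with hA_def
  have hAinv : ∀ s x, (A s x).IsInvertible := fun s x ↦
    isInvertible_curryLeft_of_nondegenerate _ (hnd x _ (hl01 s))
  set V : ℝ × E → E := fun p ↦ -(lam' p.1 • (A p.1 p.2).inverse (β p.2)) with hV_def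
  have hVs : ContDiff ℝ ∞ V := contDiff_moserField hω₀ hω₁ hβ hnd
  have hVc : HasCompactSupport V := hasCompactSupport_moserField hβc
  -- the flow of the Moser field
  have h1top : (1 : ℕ∞) ≤ ⊤ := le_top
  set Θ : ℝ × E → E := fun p ↦ Literature.Analysis.ODE.tdFlow hVs hVc h1top 0 p.1 p.2 with hΘ_def
  have hΘs : ContDiff ℝ ∞ Θ :=
    (Literature.Analysis.ODE.contDiff_tdFlow hVs hVc h1top).comp (contDiff_const.prodMk contDiff_id)
  have hflow : ∀ t y, HasDerivAt (fun s ↦ Θ (s, y)) (V (t, Θ (t, y))) t := fun t y ↦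
    Literature.Analysis.ODE.hasDerivAt_tdFlow hVs hVc h1top 0 y t
  -- the defining relation `ι_V ω = −λ' β`
  have hrel0 : ∀ s x, A s x (V (s, x)) = -(lam' s • β x) := fun s x ↦ by
    simp only [hV_def, map_neg, map_smul, (hAinv s x).self_apply_inverse]
  -- the Moser identity: `t ↦ (ρ_t^* ω_t)_y (v, w)` has zero derivative
  have hkey : ∀ (y v w : E) (t : ℝ), HasDerivAt (fun s ↦ Ω s (Θ (s, y))
      ![fderiv ℝ (fun z ↦ Θ (s, z)) y v, fderiv ℝ (fun z ↦ Θ (s, z)) y w]) 0 t := by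
    intro y v w t
    set p : E := Θ (t, y) with hp
    have hω₀d : HasFDerivAt ω₀ (fderiv ℝ ω₀ p) p := (hω₀.differentiable hinf p).hasFDerivAt
    have hω₁d : HasFDerivAt ω₁ (fderiv ℝ ω₁ p) p := (hω₁.differentiable hinf p).hasFDerivAt
    have hβd : HasFDerivAt β (fderiv ℝ β p) p := (hβ.differentiable hinf p).hasFDerivAt
    have hc : HasDerivAt (fun s ↦ Θ (s, y)) (V (t, p)) t := hflow t y
    set DΩ : E →L[ℝ] E [⋀^Fin 2]→L[ℝ] ℝ := (1 - lam t) • fderiv ℝ ω₁ p + lam t • fderiv ℝ ω₀ p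
      with hDΩ
    have hΩt : HasFDerivAt (Ω t) DΩ p := (hω₁d.const_smul (1 - lam t)).add (hω₀d.const_smul (lam t))
    -- the curve of forms `s ↦ ω_s (ρ_s y)`
    have hAcurve :
        HasDerivAt (fun s ↦ Ω s (Θ (s, y))) (lam' t • (ω₀ p - ω₁ p) + DΩ (V (t, p))) t := by
      have h1 : HasDerivAt (fun s ↦ ω₁ (Θ (s, y))) (fderiv ℝ ω₁ p (V (t, p))) t :=
        hω₁d.comp_hasDerivAt t hc
      have h0 : HasDerivAt (fun s ↦ ω₀ (Θ (s, y))) (fderiv ℝ ω₀ p (V (t, p))) t :=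
        hω₀d.comp_hasDerivAt t hc
      have hl1 : HasDerivAt (fun s ↦ 1 - lam s) (-lam' t) t := by
        simpa using (hld t).const_sub 1
      have h := (hl1.smul h1).add ((hld t).smul h0)
      refine h.congr_deriv ?_
      simp only [hDΩ, add_apply, smul_apply, smul_sub, neg_smul]
      abel
    have ha := hasDerivAt_fderiv_flow hVs hΘs hflow t y v
    have hb := hasDerivAt_fderiv_flow hVs hΘs hflow t y w
    set DX : E →L[ℝ] E := fderiv ℝ (fun z ↦ V (t, z)) p with hDX
    refine (hasDerivAt_twoForm_apply hAcurve ha hb).congr_deriv ?_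
    -- the pointwise cancellation
    have hcl : ContinuousAlternatingMap.alternatizeUncurryFin DΩ = 0 := by
      have hd1 : DifferentiableAt ℝ ((1 - lam t) • ω₁) p :=
        (hω₁d.const_smul (1 - lam t)).differentiableAt
      have hd2 : DifferentiableAt ℝ (lam t • ω₀) p :=
        (hω₀d.const_smul (lam t)).differentiableAt
      have h1 : extDeriv ((1 - lam t) • ω₁ + lam t • ω₀) p = 0 := by
        rw [extDeriv_add hd1 hd2, extDeriv_smul (1 - lam t) ω₁, extDeriv_smul (lam t) ω₀, hd₀, hd₁]
        simp
      have h2 : extDeriv (Ω t) p = 0 := h1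
      rw [extDeriv_eq_alternatizeUncurryFin, hΩt.fderiv] at h2
      exact h2
    have hB : ContinuousAlternatingMap.alternatizeUncurryFin (lam' t • fderiv ℝ β p) =
        lam' t • (ω₀ p - ω₁ p) := by
      rw [ContinuousAlternatingMap.alternatizeUncurryFin_smul, ← hdβ p,
        extDeriv_eq_alternatizeUncurryFin]
    have hrel : ∀ a, (DΩ a).curryLeft (V (t, p)) + (Ω t p).curryLeft (DX a) =
        -((lam' t • fderiv ℝ β p) a) := by
      intro a
      have hVz : HasFDerivAt (fun z ↦ V (t, z)) DX p :=
        (Literature.Analysis.FunctionSpaces.hasFDerivAt_comp_prodMk hVs hinf t p).differentiableAt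
          |>.hasFDerivAt
      have hb := (isBoundedBilinearMap_curryLeft (E := E) (F := ℝ) (k := 1)).hasFDerivAt
        (Ω t p, V (t, p))
      have hL := hb.comp p (hΩt.prodMk hVz)
      have hR : HasFDerivAt (fun z ↦ -(lam' t • β z)) (-(lam' t • fderiv ℝ β p)) p :=
        (hβd.const_smul (lam' t)).neg
      have hfun : ((fun q : (E [⋀^Fin 2]→L[ℝ] ℝ) × E ↦ q.1.curryLeft q.2) ∘
          fun z ↦ (Ω t z, V (t, z))) = fun z ↦ -(lam' t • β z) := funext (hrel0 t)
      rw [hfun] at hL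
      have heq := congrArg (fun f : E →L[ℝ] E [⋀^Fin 1]→L[ℝ] ℝ ↦ f a) (hL.unique hR)
      simp only [ContinuousLinearMap.coe_comp, Function.comp_apply, ContinuousLinearMap.prod_apply,
        IsBoundedBilinearMap.deriv_apply] at heq
      rw [add_comm] at heq
      exact heq
    have key := moser_pointwise hcl hB hrel (fderiv ℝ (fun z ↦ Θ (t, z)) y v)
      (fderiv ℝ (fun z ↦ Θ (t, z)) y w)
    simp only [ContinuousAlternatingMap.add_apply]
    exact key
  -- `t ↦ (ρ_t^* ω_t)_y (v, w)` is constant: `ρ_1^* ω₀ = ρ_0^* ω₁ = ω₁`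
  have hΘ0 : (fun z ↦ Θ (0, z)) = id := funext fun z ↦
    Literature.Analysis.ODE.tdFlow_self hVs hVc h1top 0 z
  have hΘ1 : (fun z ↦ Θ (1, z)) = Literature.Analysis.ODE.tdFlow hVs hVc h1top 0 1 := rfl
  have hΩ1 : ∀ x, Ω 1 x = ω₀ x := fun x ↦ by
    simp only [hΩ_def, hlam_def, Real.smoothTransition.one, sub_self, zero_smul, one_smul, zero_add]
  have hΩ0 : ∀ x, Ω 0 x = ω₁ x := fun x ↦ by
    simp only [hΩ_def, hlam_def, Real.smoothTransition.zero, sub_zero, zero_smul, one_smul,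
      add_zero]
  have hconst : ∀ y v w, ω₁ y ![v, w] = ω₀ (Literature.Analysis.ODE.tdFlow hVs hVc h1top 0 1 y)
      ![fderiv ℝ (Literature.Analysis.ODE.tdFlow hVs hVc h1top 0 1) y v,
        fderiv ℝ (Literature.Analysis.ODE.tdFlow hVs hVc h1top 0 1) y w] := by
    intro y v w
    have h := is_const_of_deriv_eq_zero (fun t ↦ (hkey y v w t).differentiableAt)
      (fun t ↦ (hkey y v w t).deriv) 1 0
    beta_reduce at h
    have hy0 : Θ (0, y) = y := Literature.Analysis.ODE.tdFlow_self hVs hVc h1top 0 y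
    have hy1 : Θ (1, y) = Literature.Analysis.ODE.tdFlow hVs hVc h1top 0 1 y := rfl
    rw [hΘ0, hΘ1, fderiv_id, hΩ1, hΩ0, hy0, hy1] at h
    rw [h]
    rfl
  refine ⟨Literature.Analysis.ODE.tdFlowDiffeomorph hVs hVc h1top 0 1, fun x v w ↦ ?_, ?_⟩
  · rw [Literature.Analysis.ODE.coe_tdFlowDiffeomorph]
    exact hconst x v w
  obtain ⟨R, hR⟩ := Literature.Analysis.ODE.exists_forall_le_norm_tdFlow_eq_self hVs hVc h1top
  exact ⟨R, fun x hx ↦ hR x hx 0 1⟩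

/-- **Registered helper sub-goal `helper_moserCompactSupport`** (one-line form of
`moser_compactSupport` over `Type`): Moser's isotopy with compact support on a
finite-dimensional real normed space. [cite: McDuffSalamon2017, Thm. 3.2.4] -/
theorem helper_moserCompactSupport : ∀ (E : Type) [NormedAddCommGroup E] [NormedSpace ℝ E]
    [FiniteDimensional ℝ E] (ω₀ ω₁ : E → E [⋀^Fin 2]→L[ℝ] ℝ) (β : E → E [⋀^Fin 1]→L[ℝ] ℝ),
    ContDiff ℝ ∞ ω₀ → ContDiff ℝ ∞ ω₁ → extDeriv ω₀ = 0 → extDeriv ω₁ = 0 → ContDiff ℝ ∞ β →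
    HasCompactSupport β → (∀ x, extDeriv β x = ω₀ x - ω₁ x) →
    (∀ (x : E) (t : ℝ), t ∈ Set.Icc (0 : ℝ) 1 → ∀ v, v ≠ 0 →
      ∃ w, ((1 - t) • ω₁ x + t • ω₀ x) ![v, w] ≠ 0) →
    ∃ ρ : E ≃ₘ⟮𝓘(ℝ, E), 𝓘(ℝ, E)⟯ E,
      (∀ x v w, ω₁ x ![v, w] = ω₀ (ρ x) ![fderiv ℝ ρ x v, fderiv ℝ ρ x w]) ∧
      ∃ R : ℝ, ∀ x, R ≤ ‖x‖ → ρ x = x :=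
  fun _ _ _ _ _ _ _ hω₀ hω₁ hd₀ hd₁ hβ hβc hdβ hnd ↦
    moser_compactSupport hω₀ hω₁ hd₀ hd₁ hβ hβc hdβ hnd

end Field

end Summit.SmoothPoincare4.SmoothPoincare4.Theorems.GromovRecognitionRelEnd.CrossCapLaurent

end
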